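import Summits.HodgeConjecture.HodgeConjecture.Theorems.H413E2SWIdentityCloseTriplesCM   -- ★ p811251 (A-p08 (g18)): the `b ≠ 0` TRIPLES; brings ★ letters, ★ generic split-place producers, ★ `measurePreserving_vDiagAct`
import Literature.NumberTheory.Weil1965.ThetaIntegralNullFibre   -- ★ p811176 (B-p10 (g16)): `μ̂_0 = 0` under anisotropy
import Summits.HodgeConjecture.HodgeConjecture.Theorems.H413E2SWHNormAnisotropic   -- ★ p809129 (A-p18 (g17)): `hNorm (ratPt ξ) = 0 ↔ ξ = 0` at the CM datum
import HarnessLib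

/-!
# H413 · E-2 · SW2 (iii) — I-CLOSE: the split-place frame and the TRIPLES `H₁`, `H₂` FOR EVERY FIBRE `b` (incl. `b = 0`) AT THE CM DATUM

Cell `hodgecm-mathlib`, crux H413 (`stmt-HodgeConjecture-24833`), child line `Cruxes/H413/Lines/F0_E2SiegelWeilWeilRange.lean`,
stub `stub_SW2iii_siegelWeil`, identity half; row «TRIPLES ∀ b» (F0P4-plan (g4) 2026-08-31 05:03Z → B-p02 (g19)).  PROOF lane,
`--supports stmt-HodgeConjecture-24833 --as helper`.  KERNEL MATHEMATICS ONLY (theorems; no definition, no named fact, no `sorry`).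
HC_CM is proved only modulo the 7 printed citations until rung 0 closes; nothing here is about Hodge classes.

WHAT THIS FILE DOES.  ★ `E2SWIdentityCloseTriplesCM.exists_frame_identityClose_triples` (A-p08 (g18), p811251) produces the split-place
frame `βv, fr` and the two (T2a)-triples `H₁ b` (theta side), `H₂ b` (Eisenstein side) of the (T1) outer assembly ★
`E2SWIdentityClose.doubledThetaIntegral_eq_mul_eis_of_frame` (:267–:276) for every `b ≠ 0`.  The (T1) head and ★ (T3) consume
`H₁ H₂ : ∀ b` in ONE shape; here is that shape, AT THE CM DATUM (`F` totally real, `E` totally complex, `J_V` positive definite at a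
complex embedding `τ` — the letters of ★ `E2SWHNormAnisotropic`), modulo ONE named binder for the Eisenstein side at `b = 0`:

* theta side, `b = 0`: the fibre measure `μ̂_0` of `Λ_θ,ℝ` VANISHES — ★ `UnitaryDoubling.fibreMeasure_thetaOrbitFunctionalReal_zero`
  (B-p10 (g16), [Weil1965] n° 41 (35), n° 51 «`U(0)_k` est vide») under the anisotropy `ξ ≠ 0 → hNorm ξ ≠ 0` on rational points, which
  is ★ `E2SWHNormAnisotropic.hNorm_ratPt_eq_zero_iff` (A-p18 (g17)) at the CM datum — so `H₁ 0` holds trivially (all three clauses of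
  the ZERO measure);
* Eisenstein side, `b = 0`: finiteness on compact rectangles and `(g, g⁻ᵀ)`-invariance are `b`-free (★ generic
  `FibreMeasureSplitPlace.map_fibreMeasure_prod_lt_top`, ★ `map_splitAct_map_adelicSiegelFibreMeasure_eq` with `hTμ` := ★
  `measurePreserving_vDiagAct`); the CARRIER clause `fr_* μ_0 (S_0ᶜ × Y) = 0`, `S_0 = {x ⬝ y = 0, x ≠ 0, y ≠ 0}`, splits as
  `S_0ᶜ ⊆ {x ⬝ y ≠ 0} ∪ {x = 0} ∪ {y = 0}`: the first part is null by ★ `fibreMeasure_compl` and the `≠`-free pairing letter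
  `hNorm x = b → (fr x).1.1 ⬝ᵥ (fr x).1.2 = b` (★ `exists_splitPlaceFrame`'s `hQ` read at `adeleEval`), the two COORDINATE HYPERPLANES
  by the binder `hS3E` — «`E_X` does not charge the frame hyperplanes» (A-p08 (g18)'s (S-3E), [Weil1965] n° 41: one tensor test function
  and Weil's condition (B)), stated FRAME-INTRINSICALLY for every linear frame `β` with the pairing identity `hQ` and the Haar clause, so that
  the (S-3E) theorem discharges it by name — through `μ_0 ≤ E_X` (★ `fibreMeasure_le`).
* `b ≠ 0`: the two ★ producers exactly as in ★ p811251 (★ `map_fibreMeasure_thetaOrbitFunctionalReal_identityClose_hypotheses`,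
  ★ `map_adelicSiegelFibreMeasure_identityClose_hypotheses`).

The frame is A-p01 (g13)'s ★ `E2SWSplitPlaceFrame.exists_splitPlaceFrame` (`β`, pairing identity `hQ`, Haar clause, realisation of
`(P, P⁻ᵀ)` by `v`-supported `A_h`); the letters `eH, T, hfib, hTh, hTS, hTe` are rebuilt from THAT `β` by the construction of ★
`E2SWSplitPlaceLetters.exists_splitPlaceLetters` (private `letters_of_frame`, adapted verbatim), so that `hS3E` is fed the same `β`.
HEAD: `exists_frame_identityClose_triples_all` — `∃ βv fr, he1 ∧ he2 ∧ Haar ∧ (∀ b, H₁ b) ∧ (∀ b, H₂ b)` in the binder shapes of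
★ p811126 §4 VERBATIM (`K := F_v`, `κ := Fin n`, `Y := trivialAt`, `b' b := (b : F_v)`).  Consumer: B-p03 (g23) `hfib_CM`.

References: A. Weil, *Sur la formule de Siegel dans la théorie des groupes classiques*, Acta Math. 113 (1965), Chap. IV n° 41 (35)
p. 59; Chap. V n° 46 p. 66, n° 50 pp. 73–74; Chap. VI n° 51 p. 75 [Weil1965].
-/

set_option autoImplicit false
-- the cell's `Summit.HodgeConjecture.HodgeConjecture.…` namespace repeats the summit name by design (D-0017 layout)
set_option linter.dupNamespace false

noncomputable section

open MeasureTheory NumberField Filter Topology Set IsDedekindDomain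
open scoped NNReal Matrix ENNReal RestrictedProduct ComplexOrder
open Literature.NumberTheory.Automorphic Literature.NumberTheory.Weil1964 Literature.NumberTheory.Weil1965
open Literature.NumberTheory.Weil1965.UnitaryDoubling
open Literature.NumberTheory.GelbartRogawski1991 Literature.NumberTheory.GelbartRogawski1991.UnitaryDualPair
open Literature.RepresentationTheory.HeisenbergGroup
open Literature.NumberTheory.GaloisRepresentations.IsNonarchimedeanLocalField
open Literature.NumberTheory.Automorphic.AdelicVector (evalAt trivialAt placeSplitting)
open Summit.HodgeConjecture.HodgeConjecture.Cruxes.H413.E2SWSplitPlaceFrame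
open Summit.HodgeConjecture.HodgeConjecture.Cruxes.H413.E2SWSplitPlaceLetters

namespace Summit.HodgeConjecture.HodgeConjecture.Cruxes.H413.E2SWIdentityCloseTriplesAllCM

/-- a linear equivalence from `K^m` onto `K^p × K^q` has a continuous inverse (all linear maps out of `K^p`, `K^q` are continuous).
[folklore] -/
private theorem continuous_linearEquiv_symm_prod {K : Type} [Field K] [TopologicalSpace K] [IsTopologicalRing K] {m p q : ℕ}
    (β : (Fin m → K) ≃ₗ[K] ((Fin p → K) × (Fin q → K))) : Continuous β.symm := by
  haveI : ContinuousSMul K K := ⟨continuous_mul⟩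
  have h1 : Continuous fun a : Fin p → K => β.symm.toLinearMap (LinearMap.inl K _ _ a) :=
    (β.symm.toLinearMap.comp (LinearMap.inl K _ _)).continuous_on_pi
  have h2 : Continuous fun b : Fin q → K => β.symm.toLinearMap (LinearMap.inr K _ _ b) :=
    (β.symm.toLinearMap.comp (LinearMap.inr K _ _)).continuous_on_pi
  have heq : (fun z : (Fin p → K) × (Fin q → K) => β.symm z) =
      fun z => β.symm.toLinearMap (LinearMap.inl K _ _ z.1) + β.symm.toLinearMap (LinearMap.inr K _ _ z.2) := by
    funext z
    rw [← map_add, LinearMap.inl_apply, LinearMap.inr_apply, Prod.mk_add_mk, add_zero, zero_add]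
    rfl
  have hc : Continuous fun z : (Fin p → K) × (Fin q → K) => β.symm z := by
    rw [heq]
    exact (h1.comp continuous_fst).add (h2.comp continuous_snd)
  exact hc

/-- `𝔸_F = F_∞ × 𝔸_F^∞` is Hausdorff (Mathlib instances on the two factors). [folklore] -/
private theorem t2Space_adeleRing' (K : Type*) [Field K] [NumberField K] : T2Space (AdeleRing (𝓞 K) K) := by
  haveI : T2Space (FiniteAdeleRing (𝓞 K) K) := inferInstanceAs <| T2Space
    (Πʳ w : HeightOneSpectrum (𝓞 K), [w.adicCompletion K, w.adicCompletionIntegers K])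
  haveI : T2Space (InfiniteAdeleRing K) :=
    inferInstanceAs <| T2Space ((w : InfinitePlace K) → w.Completion)
  exact inferInstanceAs <| T2Space (InfiniteAdeleRing K × FiniteAdeleRing (𝓞 K) K)

/-- if `x ⬝ᵥ y ≠ 0` then `x ≠ 0` and `y ≠ 0`. [folklore] -/
private theorem ne_zero_of_dotProduct_ne_zero {K : Type*} [NonUnitalNonAssocSemiring K] {κ : Type*} [Fintype κ]
    {x y : κ → K} (h : x ⬝ᵥ y ≠ 0) : x ≠ 0 ∧ y ≠ 0 := by
  constructor
  · rintro rfl; exact h (zero_dotProduct y)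
  · rintro rfl; exact h (dotProduct_zero x)

/-- the split-place LETTERS `eH, T, hfib, hT, hTh, hTS, hTe` built from a GIVEN frame `β` of ★ `exists_splitPlaceFrame` (its pairing
identity `hQ` and its realisation clause): the construction of ★ `E2SWSplitPlaceLetters.exists_splitPlaceLetters`, verbatim, made
parametric in `β` so that the same `β` can be fed to the (S-3E) binder.  (Adapted from ★ `E2SWSplitPlaceLetters`, A-p01 (g13).) [folklore] -/
private theorem letters_of_frame
    (F E : Type) [Field F] [NumberField F] [Field E] [NumberField E] [Algebra F E] [Algebra.IsQuadraticExtension F E]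
    (c : E ≃ₐ[F] E) {δ : E} (hcδ : c δ = -δ) (hδ : δ ≠ 0) {d : F} (hd : δ * δ = algebraMap F E d)
    (N : ℕ) {n : ℕ} (e : Fin N × Fin 1 ≃ Fin n)
    (TV : Matrix (Fin N) (Fin N) F) (hV : TV.IsSymm) (hVd : IsUnit TV.det)
    (TW : Matrix (Fin 1) (Fin 1) F) (hW : TW.IsSymm) (hWd : IsUnit TW.det)
    (v : HeightOneSpectrum (𝓞 F))
    (β : (Fin (n + n) → v.adicCompletion F) ≃ₗ[v.adicCompletion F] ((Fin n → v.adicCompletion F) × (Fin n → v.adicCompletion F)))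
    (hQ : ∀ x : Fin (n + n) → AdeleRing (𝓞 F) F,
      AdelicGroupData.adeleEval F v (hNorm F E c hcδ hδ N e TV hVd TW hWd x) =
        (β (evalAt F (Fin (n + n)) v x)).1 ⬝ᵥ (β (evalAt F (Fin (n + n)) v x)).2)
    (hreal : ∀ P : GL (Fin n) (v.adicCompletion F), ∃ hU : UnitaryGroup.adelic F E c N (TV.map (algebraMap F E)),
        (∀ y ∈ trivialAt F (Fin (n + n)) v, vDiagAct F E c hcδ hδ hd N e TV hV hVd TW hW hWd hU y = y) ∧
        (∀ x : Fin (n + n) → AdeleRing (𝓞 F) F,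
          β (evalAt F (Fin (n + n)) v (vDiagAct F E c hcδ hδ hd N e TV hV hVd TW hW hWd hU x)) =
            ((P : Matrix (Fin n) (Fin n) (v.adicCompletion F)) *ᵥ (β (evalAt F (Fin (n + n)) v x)).1,
              ((P⁻¹ : GL (Fin n) (v.adicCompletion F)) : Matrix (Fin n) (Fin n) (v.adicCompletion F))ᵀ *ᵥ
                (β (evalAt F (Fin (n + n)) v x)).2)) ∧
        (∀ x : Fin (n + n) → AdeleRing (𝓞 F) F,
          ((placeSplitting F (Fin (n + n)) v).symm (vDiagAct F E c hcδ hδ hd N e TV hV hVd TW hW hWd hU x)).2 =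
            ((placeSplitting F (Fin (n + n)) v).symm x).2)) :
    ∃ (eH : (Fin (n + n) → AdeleRing (𝓞 F) F) ≃ₜ
        ((Fin n → v.adicCompletion F) × (Fin n → v.adicCompletion F)) × trivialAt F (Fin (n + n)) v)
      (T : GL (Fin n) (v.adicCompletion F) → ((Fin (n + n) → AdeleRing (𝓞 F) F) ≃ₜ (Fin (n + n) → AdeleRing (𝓞 F) F))),
      (∀ x, eH x = (β (evalAt F (Fin (n + n)) v x), ((placeSplitting F (Fin (n + n)) v).symm x).2)) ∧
      (∀ (x : Fin (n + n) → AdeleRing (𝓞 F) F) (b : F),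
        hNorm F E c hcδ hδ N e TV hVd TW hWd x = algebraMap F (AdeleRing (𝓞 F) F) b →
          (eH x).1.1 ⬝ᵥ (eH x).1.2 = (b : v.adicCompletion F)) ∧
      (∀ g, ∃ hU : UnitaryGroup.adelic F E c N (TV.map (algebraMap F E)),
        ⇑(T g) = ⇑(vDiagAct F E c hcδ hδ hd N e TV hV hVd TW hW hWd hU)) ∧
      (∀ g x, hNorm F E c hcδ hδ N e TV hVd TW hWd (T g x) = hNorm F E c hcδ hδ N e TV hVd TW hWd x) ∧
      (∀ g, ∀ Φ ∈ piSchwartzBruhat F (Fin (n + n)), Φ ∘ ⇑(T g) ∈ piSchwartzBruhat F (Fin (n + n))) ∧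
      (∀ g x, eH (T g x) =
        ((((g : Matrix (Fin n) (Fin n) (v.adicCompletion F)) *ᵥ (eH x).1.1,
            ((g⁻¹ : GL (Fin n) (v.adicCompletion F)) : Matrix (Fin n) (Fin n) (v.adicCompletion F))ᵀ *ᵥ (eH x).1.2) :
              (Fin n → v.adicCompletion F) × (Fin n → v.adicCompletion F)), (eH x).2)) := by
  choose sel hfix hii hsnd using hreal
  haveI : ContinuousSMul (v.adicCompletion F) (v.adicCompletion F) := ⟨continuous_mul⟩
  haveI : ContinuousSMul (AdeleRing (𝓞 F) F) (AdeleRing (𝓞 F) F) := ⟨continuous_mul⟩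
  -- `β` as a homeomorphism, `e := (β × id) ∘ placeSplitting⁻¹`
  let βH : (Fin (n + n) → v.adicCompletion F) ≃ₜ ((Fin n → v.adicCompletion F) × (Fin n → v.adicCompletion F)) :=
    { toEquiv := β.toEquiv
      continuous_toFun := β.toLinearMap.continuous_on_pi
      continuous_invFun := continuous_linearEquiv_symm_prod β }
  let eH : (Fin (n + n) → AdeleRing (𝓞 F) F) ≃ₜ
      ((Fin n → v.adicCompletion F) × (Fin n → v.adicCompletion F)) × trivialAt F (Fin (n + n)) v :=
    (placeSplitting F (Fin (n + n)) v).symm.toHomeomorph.trans (βH.prodCongr (Homeomorph.refl _))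
  -- `T g := A_{sel g}` as a homeomorphism
  let T : GL (Fin n) (v.adicCompletion F) → ((Fin (n + n) → AdeleRing (𝓞 F) F) ≃ₜ (Fin (n + n) → AdeleRing (𝓞 F) F)) :=
    fun g =>
      { toEquiv := (vDiagAct F E c hcδ hδ hd N e TV hV hVd TW hW hWd (sel g)).toEquiv
        continuous_toFun := (vDiagAct F E c hcδ hδ hd N e TV hV hVd TW hW hWd (sel g)).toLinearMap.continuous_on_pi
        continuous_invFun := (vDiagAct F E c hcδ hδ hd N e TV hV hVd TW hW hWd (sel g)).symm.toLinearMap.continuous_on_pi }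
  have heH : ∀ x, eH x = (β (evalAt F (Fin (n + n)) v x), ((placeSplitting F (Fin (n + n)) v).symm x).2) := fun x => rfl
  have hT : ∀ g, ⇑(T g) = ⇑(vDiagAct F E c hcδ hδ hd N e TV hV hVd TW hW hWd (sel g)) := fun g => rfl
  refine ⟨eH, T, heH, fun x b hxb => ?_, fun g => ⟨sel g, hT g⟩, fun g x => ?_, fun g Φ hΦ => ?_, fun g x => ?_⟩
  · -- `hfib` core (pairing letter)
    rw [heH]
    change (β (evalAt F (Fin (n + n)) v x)).1 ⬝ᵥ (β (evalAt F (Fin (n + n)) v x)).2 = _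
    rw [← hQ x, hxb]
    rfl
  · -- `hTh`
    exact hNorm_vDiagAct F E c hcδ hδ hd N e TV hV hVd TW hW hWd (sel g) x
  · -- `hTS`
    have hc : Φ ∘ ⇑(T g) = twist F (actTwistGL F (vDiagAct F E c hcδ hδ hd N e TV hV hVd TW hW hWd) (sel g)) Φ :=
      funext fun x => (twist_actTwistGL F (vDiagAct F E c hcδ hδ hd N e TV hV hVd TW hW hWd) (sel g) Φ x).symm
    rw [hc]
    exact twist_mem hΦ _
  · -- `hTe`
    rw [heH, heH]
    change (β (evalAt F (Fin (n + n)) v (vDiagAct F E c hcδ hδ hd N e TV hV hVd TW hW hWd (sel g) x)),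
        ((placeSplitting F (Fin (n + n)) v).symm (vDiagAct F E c hcδ hδ hd N e TV hV hVd TW hW hWd (sel g) x)).2) = _
    rw [hii g x, hsnd g x]

variable (F E : Type) [Field F] [NumberField F] [Field E] [NumberField E] [Algebra F E] [Algebra.IsQuadraticExtension F E]
  (c : E ≃ₐ[F] E) {δ : E} (hcδ : c δ = -δ) (hδ : δ ≠ 0) {d : F} (hd : δ * δ = algebraMap F E d)
  (N : ℕ) {n : ℕ} (e : Fin N × Fin 1 ≃ Fin n)
  (TV : Matrix (Fin N) (Fin N) F) (hV : TV.IsSymm) (hVd : IsUnit TV.det)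
  (TW : Matrix (Fin 1) (Fin 1) F) (hW : TW.IsSymm) (hWd : IsUnit TW.det)
  [LocallyCompactSpace (UnitaryGroup.adelic F E c N (TV.map (algebraMap F E)))]
  [CompactSpace (UnitaryGroup.adelic F E c N (TV.map (algebraMap F E)) ⧸ (UnitaryGroup.toAdelic F E c N (TV.map (algebraMap F E))).range)]
  [MeasurableSpace (UnitaryGroup.adelic F E c N (TV.map (algebraMap F E)) ⧸ (UnitaryGroup.toAdelic F E c N (TV.map (algebraMap F E))).range)]
  [BorelSpace (UnitaryGroup.adelic F E c N (TV.map (algebraMap F E)) ⧸ (UnitaryGroup.toAdelic F E c N (TV.map (algebraMap F E))).range)]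
  (ν : Measure (UnitaryGroup.adelic F E c N (TV.map (algebraMap F E)) ⧸ (UnitaryGroup.toAdelic F E c N (TV.map (algebraMap F E))).range))
  [IsFiniteMeasure ν]
  [SMulInvariantMeasure (UnitaryGroup.adelic F E c N (TV.map (algebraMap F E)))
    (UnitaryGroup.adelic F E c N (TV.map (algebraMap F E)) ⧸ (UnitaryGroup.toAdelic F E c N (TV.map (algebraMap F E))).range) ν]
  [MeasurableSpace (adeleQuotient F)] [BorelSpace (adeleQuotient F)]
  [MeasurableSpace (AdeleRing (𝓞 F) F)] [BorelSpace (AdeleRing (𝓞 F) F)]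
  (νX : Measure (Fin (n + n) → AdeleRing (𝓞 F) F)) [νX.IsAddHaarMeasure]
  (h : (Fin (n + n) → AdeleRing (𝓞 F) F) → AdeleRing (𝓞 F) F) (hh : Continuous h)
  (v : HeightOneSpectrum (𝓞 F))
  [MeasurableSpace (v.adicCompletion F)] [BorelSpace (v.adicCompletion F)]
  (μK : Measure (v.adicCompletion F)) [μK.IsAddHaarMeasure]

include hδ μK in
/-- **THE SPLIT-PLACE FRAME AND THE TWO (T2a)-TRIPLES FOR EVERY FIBRE `b : F` AT THE CM DATUM** (the `βv fr he1 he2 H₁ H₂` binders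
of (T1) ★ `E2SWIdentityClose.doubledThetaIntegral_eq_mul_eis_of_frame`, `H₁ H₂ : ∀ b`, `b' b := (b : F_v)`).  Hypotheses: the
(T1) letters `hhN`, `hB`; a split place `v` (`s² = d` in `F_v`); the CM letters `[IsTotallyReal F] [IsTotallyComplex E]` and a complex
embedding `τ` at which `J_V` is positive definite (anisotropy, ★ `hNorm_ratPt_eq_zero_iff`); and the (S-3E) binder `hS3E` — «`E_X`
does not charge the coordinate hyperplanes of a split-place frame»: for every linear frame `β` with the pairing identity
`(hNorm x)_v = (β x_v).1 ⬝ᵥ (β x_v).2` and the Haar clause, `E_X {x | (β x_v).1 = 0} = 0` and `E_X {x | (β x_v).2 = 0} = 0`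
(A-p08 (g18)'s (S-3E) theorem discharges it by name).  Conclusion: a frame `βv, fr` with `he1`, `he2`, the Haar clause, and
`H₁ b`, `H₂ b` for EVERY `b` — at `b ≠ 0` the ★ producers of ★ p811251; at `b = 0` the theta side by `μ̂_0 = 0`
(★ `fibreMeasure_thetaOrbitFunctionalReal_zero`), the Eisenstein side by the `b`-free finiteness ∕ invariance and the carrier
split `S_0ᶜ ⊆ {x ⬝ y ≠ 0} ∪ {x = 0} ∪ {y = 0}` (★ `fibreMeasure_compl` + pairing letter; `hS3E` through ★ `fibreMeasure_le`).
[cite: Weil1965, Chap. IV n° 41 (35) p. 59; Chap. V n° 46 p. 66, n° 50 pp. 73–74; Chap. VI n° 51 p. 75] -/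
theorem exists_frame_identityClose_triples_all
    (hhN : ∀ x, h x = hNorm F E c hcδ hδ N e TV hVd TW hWd x)
    (hB : ∀ Φ ∈ piSchwartzBruhat F (Fin (n + n)), Summable fun ξ : F => ‖adelicSiegelCoeff F (Fin (n + n)) νX h Φ ξ‖)
    {s : v.adicCompletion F} (hs : s * s = algebraMap F (v.adicCompletion F) d)
    [IsTotallyReal F] [IsTotallyComplex E] (τ : E →+* ℂ) (hτ : ((TV.map (algebraMap F E)).map τ).PosDef)
    (hS3E : ∀ β : (Fin (n + n) → v.adicCompletion F) ≃ₗ[v.adicCompletion F]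
        ((Fin n → v.adicCompletion F) × (Fin n → v.adicCompletion F)),
      (∀ x : Fin (n + n) → AdeleRing (𝓞 F) F,
        AdelicGroupData.adeleEval F v (hNorm F E c hcδ hδ N e TV hVd TW hWd x) =
          (β (evalAt F (Fin (n + n)) v x)).1 ⬝ᵥ (β (evalAt F (Fin (n + n)) v x)).2) →
      (∃ cst : ℝ≥0, 0 < cst ∧
        Measure.map β (Measure.pi fun _ : Fin (n + n) => μK) =
          (cst : ℝ≥0∞) • ((Measure.pi fun _ : Fin n => μK).prod (Measure.pi fun _ : Fin n => μK))) →
      adelicSiegelMeasure F (Fin (n + n)) νX h hh hB {x | (β (evalAt F (Fin (n + n)) v x)).1 = 0} = 0 ∧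
        adelicSiegelMeasure F (Fin (n + n)) νX h hh hB {x | (β (evalAt F (Fin (n + n)) v x)).2 = 0} = 0) :
    ∃ (βv : (Fin (n + n) → v.adicCompletion F) ≃ₜ ((Fin n → v.adicCompletion F) × (Fin n → v.adicCompletion F)))
      (fr : (Fin (n + n) → AdeleRing (𝓞 F) F) ≃ₜ
        (((Fin n → v.adicCompletion F) × (Fin n → v.adicCompletion F)) × trivialAt F (Fin (n + n)) v)),
      (∀ x, (fr x).1 = βv (evalAt F (Fin (n + n)) v x)) ∧
      (∀ x, (fr x).2 = ((placeSplitting F (Fin (n + n)) v).symm x).2) ∧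
      (∃ cst : ℝ≥0, 0 < cst ∧
        Measure.map βv (Measure.pi fun _ : Fin (n + n) => μK) =
          (cst : ℝ≥0∞) • ((Measure.pi fun _ : Fin n => μK).prod (Measure.pi fun _ : Fin n => μK))) ∧
      (∀ b : F,
        (∀ (L : Set ((Fin n → v.adicCompletion F) × (Fin n → v.adicCompletion F))) (B : Set (trivialAt F (Fin (n + n)) v)),
            IsCompact L → IsCompact B →
          ((fibreMeasure F (Fin (n + n)) (thetaOrbitFunctionalReal F E c hcδ hδ hd N e TV hV hVd TW hW hWd ν)
            (thetaOrbitFunctionalReal_nonneg F E c hcδ hδ hd N e TV hV hVd TW hW hWd ν) h b).map fr) (L ×ˢ B) < ⊤) ∧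
        (∀ (g : GL (Fin n) (v.adicCompletion F)) (A : Set ((Fin n → v.adicCompletion F) × (Fin n → v.adicCompletion F)))
            (B : Set (trivialAt F (Fin (n + n)) v)), MeasurableSet A → MeasurableSet B →
          ((fibreMeasure F (Fin (n + n)) (thetaOrbitFunctionalReal F E c hcδ hδ hd N e TV hV hVd TW hW hWd ν)
            (thetaOrbitFunctionalReal_nonneg F E c hcδ hδ hd N e TV hV hVd TW hW hWd ν) h b).map fr)
            (((fun z => (((g : Matrix (Fin n) (Fin n) (v.adicCompletion F)) *ᵥ z.1,
                ((g⁻¹ : GL (Fin n) (v.adicCompletion F)) : Matrix (Fin n) (Fin n) (v.adicCompletion F))ᵀ *ᵥ z.2) :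
                  (Fin n → v.adicCompletion F) × (Fin n → v.adicCompletion F))) ⁻¹' A) ×ˢ B) =
          ((fibreMeasure F (Fin (n + n)) (thetaOrbitFunctionalReal F E c hcδ hδ hd N e TV hV hVd TW hW hWd ν)
            (thetaOrbitFunctionalReal_nonneg F E c hcδ hδ hd N e TV hV hVd TW hW hWd ν) h b).map fr) (A ×ˢ B)) ∧
        ((fibreMeasure F (Fin (n + n)) (thetaOrbitFunctionalReal F E c hcδ hδ hd N e TV hV hVd TW hW hWd ν)
            (thetaOrbitFunctionalReal_nonneg F E c hcδ hδ hd N e TV hV hVd TW hW hWd ν) h b).map fr)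
          ({z : (Fin n → v.adicCompletion F) × (Fin n → v.adicCompletion F) |
              z.1 ⬝ᵥ z.2 = (b : v.adicCompletion F) ∧ z.1 ≠ 0 ∧ z.2 ≠ 0}ᶜ ×ˢ (univ : Set (trivialAt F (Fin (n + n)) v))) = 0) ∧
      (∀ b : F,
        (∀ (L : Set ((Fin n → v.adicCompletion F) × (Fin n → v.adicCompletion F))) (B : Set (trivialAt F (Fin (n + n)) v)),
            IsCompact L → IsCompact B →
          ((adelicSiegelFibreMeasure F (Fin (n + n)) νX h hh hB b).map fr) (L ×ˢ B) < ⊤) ∧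
        (∀ (g : GL (Fin n) (v.adicCompletion F)) (A : Set ((Fin n → v.adicCompletion F) × (Fin n → v.adicCompletion F)))
            (B : Set (trivialAt F (Fin (n + n)) v)), MeasurableSet A → MeasurableSet B →
          ((adelicSiegelFibreMeasure F (Fin (n + n)) νX h hh hB b).map fr)
            (((fun z => (((g : Matrix (Fin n) (Fin n) (v.adicCompletion F)) *ᵥ z.1,
                ((g⁻¹ : GL (Fin n) (v.adicCompletion F)) : Matrix (Fin n) (Fin n) (v.adicCompletion F))ᵀ *ᵥ z.2) :
                  (Fin n → v.adicCompletion F) × (Fin n → v.adicCompletion F))) ⁻¹' A) ×ˢ B) =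
          ((adelicSiegelFibreMeasure F (Fin (n + n)) νX h hh hB b).map fr) (A ×ˢ B)) ∧
        ((adelicSiegelFibreMeasure F (Fin (n + n)) νX h hh hB b).map fr)
          ({z : (Fin n → v.adicCompletion F) × (Fin n → v.adicCompletion F) |
              z.1 ⬝ᵥ z.2 = (b : v.adicCompletion F) ∧ z.1 ≠ 0 ∧ z.2 ≠ 0}ᶜ ×ˢ (univ : Set (trivialAt F (Fin (n + n)) v))) = 0) := by
  -- the E-side norm letter IS `hNorm`
  obtain rfl : h = hNorm F E c hcδ hδ N e TV hVd TW hWd := funext hhN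
  haveI : T2Space (AdeleRing (𝓞 F) F) := t2Space_adeleRing' F
  haveI : T2Space (trivialAt F (Fin (n + n)) v) := inferInstance
  haveI := secondCountableTopology_adeleRing (K := F)
  haveI : BorelSpace (Fin (n + n) → AdeleRing (𝓞 F) F) := Pi.borelSpace
  haveI := AdelicVector.secondCountableTopology_trivialAt (K := F) (ι := Fin (n + n)) (v := v)
  haveI : BorelSpace (trivialAt F (Fin (n + n)) v) := Subtype.borelSpace _
  haveI : SecondCountableTopology (v.adicCompletion F) := secondCountableTopology_localField _
  haveI : BorelSpace (Fin n → v.adicCompletion F) := Pi.borelSpace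
  haveI : BorelSpace ((Fin n → v.adicCompletion F) × (Fin n → v.adicCompletion F)) := Prod.borelSpace
  haveI : BorelSpace (((Fin n → v.adicCompletion F) × (Fin n → v.adicCompletion F)) × trivialAt F (Fin (n + n)) v) :=
    Prod.borelSpace
  -- A-p01's frame, and its letters rebuilt from the SAME `β`
  obtain ⟨β, hQ, hHaar, hreal⟩ := exists_splitPlaceFrame F E c hcδ hδ hd N e TV hV hVd TW hW hWd v hs μK
  obtain ⟨eH, T, heH, hfib0, hT, hTh, hTS, hTe⟩ := letters_of_frame F E c hcδ hδ hd N e TV hV hVd TW hW hWd v β hQ hreal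
  choose sel hsel using hT
  haveI : ContinuousSMul (v.adicCompletion F) (v.adicCompletion F) := ⟨continuous_mul⟩
  let βH : (Fin (n + n) → v.adicCompletion F) ≃ₜ ((Fin n → v.adicCompletion F) × (Fin n → v.adicCompletion F)) :=
    { toEquiv := β.toEquiv
      continuous_toFun := β.toLinearMap.continuous_on_pi
      continuous_invFun := continuous_linearEquiv_symm_prod β }
  -- (S-3E) at this frame
  obtain ⟨hE1, hE2⟩ := hS3E β hQ hHaar
  -- anisotropy at the CM datum ⇒ `μ̂_0 = 0`
  have hanis : ∀ ξ : Fin (n + n) → F, ξ ≠ 0 → hNorm F E c hcδ hδ N e TV hVd TW hWd (ratPt F (Fin (n + n)) ξ) ≠ 0 :=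
    fun ξ hξ h0 => hξ ((E2SWHNormAnisotropic.hNorm_ratPt_eq_zero_iff F E c hcδ hδ hd N e TV hV hVd TW hW hWd τ hτ ξ).mp h0)
  have hμ0 : fibreMeasure F (Fin (n + n)) (thetaOrbitFunctionalReal F E c hcδ hδ hd N e TV hV hVd TW hW hWd ν)
      (thetaOrbitFunctionalReal_nonneg F E c hcδ hδ hd N e TV hV hVd TW hW hWd ν) (hNorm F E c hcδ hδ N e TV hVd TW hWd) 0 = 0 :=
    fibreMeasure_thetaOrbitFunctionalReal_zero F E c hcδ hδ hd N e TV hV hVd TW hW hWd ν hanis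
  -- `hfib` with the non-vanishing clauses, for `b ≠ 0`
  have hfib : ∀ b : F, b ≠ 0 → ∀ x, hNorm F E c hcδ hδ N e TV hVd TW hWd x = algebraMap F (AdeleRing (𝓞 F) F) b →
      (eH x).1.1 ⬝ᵥ (eH x).1.2 = (b : v.adicCompletion F) ∧ (eH x).1.1 ≠ 0 ∧ (eH x).1.2 ≠ 0 := by
    intro b hb x hxb
    have h1 := hfib0 x b hxb
    have hb' : ((b : v.adicCompletion F)) ≠ 0 := by
      rw [ne_eq, ← map_zero (algebraMap F (v.adicCompletion F))]
      exact fun h0 => hb ((algebraMap F (v.adicCompletion F)).injective h0)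
    exact ⟨h1, ne_zero_of_dotProduct_ne_zero (h1 ▸ hb')⟩
  -- `hTe` in selector form (theta side) and `hTμ` (Eisenstein side)
  have hTe' : ∀ g x, eH (vDiagAct F E c hcδ hδ hd N e TV hV hVd TW hW hWd (sel g) x) =
      ((((g : Matrix (Fin n) (Fin n) (v.adicCompletion F)) *ᵥ (eH x).1.1,
          ((g⁻¹ : GL (Fin n) (v.adicCompletion F)) : Matrix (Fin n) (Fin n) (v.adicCompletion F))ᵀ *ᵥ (eH x).1.2) :
            (Fin n → v.adicCompletion F) × (Fin n → v.adicCompletion F)), (eH x).2) := fun g x => by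
    rw [← hTe g x, hsel g]
  have hTμ : ∀ g, MeasurePreserving (T g) νX νX := fun g => by
    have h1 := measurePreserving_vDiagAct F E c hcδ hδ hd N e TV hV hVd TW hW hWd νX (sel g)
    have h2 : (⇑(T g) : (Fin (n + n) → AdeleRing (𝓞 F) F) → (Fin (n + n) → AdeleRing (𝓞 F) F)) =
        ⇑(vDiagAct F E c hcδ hδ hd N e TV hV hVd TW hW hWd (sel g)) := hsel g
    rw [h2]; exact h1
  have hem : Measurable eH := eH.continuous.measurable
  refine ⟨βH, eH, fun x => by rw [heH]; rfl, fun x => by rw [heH], hHaar, fun b => ?_, fun b => ?_⟩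
  · -- `H₁ b`: the theta side
    by_cases hb : b = 0
    · -- `b = 0`: `μ̂_0 = 0`
      subst hb
      have hz : (fibreMeasure F (Fin (n + n)) (thetaOrbitFunctionalReal F E c hcδ hδ hd N e TV hV hVd TW hW hWd ν)
          (thetaOrbitFunctionalReal_nonneg F E c hcδ hδ hd N e TV hV hVd TW hW hWd ν) (hNorm F E c hcδ hδ N e TV hVd TW hWd) 0).map eH = 0 := by
        rw [hμ0, Measure.map_zero]
      refine ⟨fun L B _ _ => ?_, fun g A B _ _ => ?_, ?_⟩
      · rw [hz]; exact ENNReal.zero_lt_top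
      · rw [hz]; rfl
      · rw [hz]; rfl
    · exact map_fibreMeasure_thetaOrbitFunctionalReal_identityClose_hypotheses F E c hcδ hδ hd N e TV hV hVd TW hW hWd ν eH b
        (b : v.adicCompletion F) (hfib b hb) sel hTe'
  · -- `H₂ b`: the Eisenstein side
    by_cases hb : b = 0
    · subst hb
      refine ⟨fun L B hL hBc => ?_, fun g A B hA hBm => ?_, ?_⟩
      · -- finiteness on compact rectangles (`b`-free)
        exact map_fibreMeasure_prod_lt_top F (Fin (n + n)) _ _ (hNorm F E c hcδ hδ N e TV hVd TW hWd) eH (0 : F) hL hBc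
      · -- invariance on Borel rectangles (`b`-free)
        set G : (Fin n → v.adicCompletion F) × (Fin n → v.adicCompletion F) →
            (Fin n → v.adicCompletion F) × (Fin n → v.adicCompletion F) := fun z =>
          (((g : Matrix (Fin n) (Fin n) (v.adicCompletion F)) *ᵥ z.1,
            ((g⁻¹ : GL (Fin n) (v.adicCompletion F)) : Matrix (Fin n) (Fin n) (v.adicCompletion F))ᵀ *ᵥ z.2) :
              (Fin n → v.adicCompletion F) × (Fin n → v.adicCompletion F)) with hG
        set GG : ((Fin n → v.adicCompletion F) × (Fin n → v.adicCompletion F)) × trivialAt F (Fin (n + n)) v →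
            ((Fin n → v.adicCompletion F) × (Fin n → v.adicCompletion F)) × trivialAt F (Fin (n + n)) v :=
          fun z => (G z.1, z.2) with hGG
        have hGm : Measurable G :=
          ((continuous_const.matrix_mulVec continuous_fst).prodMk (continuous_const.matrix_mulVec continuous_snd)).measurable
        have hGGm : Measurable GG := (hGm.comp measurable_fst).prodMk measurable_snd
        have hpre : (G ⁻¹' A) ×ˢ B = GG ⁻¹' (A ×ˢ B) := by
          ext z; simp only [mem_prod, mem_preimage, hGG]
        have hGGν : ((adelicSiegelFibreMeasure F (Fin (n + n)) νX (hNorm F E c hcδ hδ N e TV hVd TW hWd) hh hB 0).map eH).map GG =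
            (adelicSiegelFibreMeasure F (Fin (n + n)) νX (hNorm F E c hcδ hδ N e TV hVd TW hWd) hh hB 0).map eH := by
          simpa only [hGG, hG] using
            map_splitAct_map_adelicSiegelFibreMeasure_eq F (Fin (n + n)) νX (hNorm F E c hcδ hδ N e TV hVd TW hWd) hh hB eH (0 : F)
              T hTμ hTh hTS hTe g
        rw [hpre, ← Measure.map_apply hGGm (hA.prod hBm), hGGν]
      · -- the carrier at `b = 0`: pairing letter + (S-3E)
        have hSm : MeasurableSet ({z : (Fin n → v.adicCompletion F) × (Fin n → v.adicCompletion F) |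
            z.1 ⬝ᵥ z.2 = ((0 : F) : v.adicCompletion F) ∧ z.1 ≠ 0 ∧ z.2 ≠ 0}ᶜ ×ˢ (univ : Set (trivialAt F (Fin (n + n)) v))) := by
          refine MeasurableSet.prod (MeasurableSet.compl ?_) MeasurableSet.univ
          have h1 : MeasurableSet {z : (Fin n → v.adicCompletion F) × (Fin n → v.adicCompletion F) |
              z.1 ⬝ᵥ z.2 = ((0 : F) : v.adicCompletion F)} :=
            (isClosed_eq (continuous_fst.dotProduct continuous_snd) continuous_const).measurableSet
          have h2 : MeasurableSet {z : (Fin n → v.adicCompletion F) × (Fin n → v.adicCompletion F) | z.1 ≠ 0} :=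
            (isClosed_eq continuous_fst continuous_const).measurableSet.compl
          have h3 : MeasurableSet {z : (Fin n → v.adicCompletion F) × (Fin n → v.adicCompletion F) | z.2 ≠ 0} :=
            (isClosed_eq continuous_snd continuous_const).measurableSet.compl
          simpa only [setOf_and] using h1.inter (h2.inter h3)
        rw [Measure.map_apply hem hSm]
        have hsub : eH ⁻¹' ({z : (Fin n → v.adicCompletion F) × (Fin n → v.adicCompletion F) |
              z.1 ⬝ᵥ z.2 = ((0 : F) : v.adicCompletion F) ∧ z.1 ≠ 0 ∧ z.2 ≠ 0}ᶜ ×ˢ (univ : Set (trivialAt F (Fin (n + n)) v))) ⊆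
            ((hNorm F E c hcδ hδ N e TV hVd TW hWd) ⁻¹' {algebraMap F (AdeleRing (𝓞 F) F) 0})ᶜ ∪
              ({x | (β (evalAt F (Fin (n + n)) v x)).1 = 0} ∪ {x | (β (evalAt F (Fin (n + n)) v x)).2 = 0}) := by
          intro x hx
          simp only [mem_preimage, mem_prod, mem_univ, and_true, mem_compl_iff, mem_setOf_eq] at hx
          by_cases hxb : hNorm F E c hcδ hδ N e TV hVd TW hWd x = algebraMap F (AdeleRing (𝓞 F) F) 0
          · have hpair := hfib0 x 0 hxb
            have h12 : (eH x).1 = β (evalAt F (Fin (n + n)) v x) := by rw [heH]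
            right
            by_contra hcon
            simp only [mem_union, mem_setOf_eq, not_or] at hcon
            rw [← h12] at hcon
            exact hx ⟨hpair, hcon.1, hcon.2⟩
          · left
            exact hxb
        refine measure_mono_null hsub (measure_union_null ?_ (measure_union_null ?_ ?_))
        · exact fibreMeasure_compl F (Fin (n + n)) _ _ (hNorm F E c hcδ hδ N e TV hVd TW hWd)
            (continuous_hNorm F E c hcδ hδ N e TV hVd TW hWd) 0
        · exact le_antisymm ((Measure.le_iff'.1 (fibreMeasure_le F (Fin (n + n)) _ _ (hNorm F E c hcδ hδ N e TV hVd TW hWd) 0) _).trans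
            hE1.le) bot_le
        · exact le_antisymm ((Measure.le_iff'.1 (fibreMeasure_le F (Fin (n + n)) _ _ (hNorm F E c hcδ hδ N e TV hVd TW hWd) 0) _).trans
            hE2.le) bot_le
    · exact map_adelicSiegelFibreMeasure_identityClose_hypotheses F (Fin (n + n)) νX _ hh hB eH b (b : v.adicCompletion F)
        (hfib b hb) T hTμ hTh hTS hTe

end Summit.HodgeConjecture.HodgeConjecture.Cruxes.H413.E2SWIdentityCloseTriplesAllCM

end
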